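import Summits.CriticalPhenomena.SAWScalingLimit.Theorems.SAWDevelopingMapInteriorFlatteningOneMouthEstimates

/-!
# `InteriorFlattening` (stmt-CriticalPhenomena-8297), line `one-mouth-ball-reduction`:
# S5'(ii) — fixed-radius re-entries — as a CONDITIONAL reduction to the named estimates E1 + E2

Crux (M) = `Summit.CriticalPhenomena.SAWScalingLimit.Theses.SAWDevelopingMap.InteriorFlattening`; stub S5'
`stub_reentryArmSeparation` (windowed at reshape r2: `B(v,2r) ⊆ Λ`, `¬ B(v,4r) ⊆ Λ`) of the skeleton
`Cruxes/InteriorFlattening/Lines/one_mouth_ball_reduction.lean`. The stub itself is research-level open (no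
multi-arm / separation technology for planar SAW at `n = 0`) and is NOT proved here. This file kernel-checks
that its SECOND conjunct,

  (ii) for every fixed radius `d₀ ≥ 0` and `ϑ > 0`, for `r ≥ r₀(d₀, ϑ)`: the last-entrance configurations
       `c` of `S = B(v,r)` that are unclean at `d₀` carry, even in inner-MASS weight `‖amp_c‖ · pmass_c`, at
       most `ϑ · Σ_c ‖amp_c‖ ‖M_c‖`,

FOLLOWS from two of the named (open, NOT asserted) estimates of
`…Theorems.SAWDevelopingMapInteriorFlatteningOneMouthEstimates`, entering ONLY AS HYPOTHESES:

* `CoherentReentryGap ρ` (E1): unclean-at-`t` configurations carry `≤ C (t/r)^ρ` of `Σ ‖amp‖·pmass`;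
* `CleanMonopoleLowerBound κ` (E2): realisable configurations clean at `θ r` have `‖M_c‖ ≥ c₀ r^{-κ} pmass_c`;

with `0 ≤ κ < ρ` (heuristically `κ = 25/48`, `ρ = 3/2`). Proof (`reentryFixedRadius_of_armEstimates`): pick an
aspect `θ` with `C θ^ρ ≤ 1/2`, so by E1 at `t = θr` at least half of the `‖amp‖·pmass` weight is clean at
`θr`; on those E2 converts `pmass` into `‖M‖` at the price `c₀⁻¹ r^κ`; E1 at `t₀ = max d₀ 1` then bounds the
left side by `2 C c₀⁻¹ t₀^ρ · r^{κ-ρ} · Σ ‖amp‖‖M‖ → 0`. The first conjunct and the assembled two-conjunct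
statement are in `…Theorems.SAWDevelopingMapInteriorFlatteningReentryReduction`. Also here: the elementary
glue `pmass_nonneg` and two nested-filter sum comparisons, reused by that file.
-/

noncomputable section

open scoped BigOperators
open Literature.Probability.LatticeModels Literature.Probability.RandomPlanarGeometry.SAW

namespace Summit.CriticalPhenomena.SAWScalingLimit.Theorems.InteriorFlattening.OneMouth

/-! ### Elementary glue -/

/-- `pmass ≥ 0` (a sum of powers of `x_c ≥ 0`). -/
theorem pmass_nonneg (D : Finset HexVertex) (q : Sym2 HexVertex) (v w₀ w₁ w₂ : HexVertex) :
    0 ≤ pmass D q v w₀ w₁ w₂ := by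
  unfold pmass zmass
  have := xc_nonneg
  positivity

/-- Sub-sums of nonnegative real terms over nested filters of one `Finset` are monotone. -/
theorem sum_filter_le_sum_filter_of_imp {ι : Type*} (s : Finset ι) (f : ι → ℝ) (p q : ι → Prop)
    [DecidablePred p] [DecidablePred q] (hpq : ∀ i ∈ s, p i → q i) (hf : ∀ i ∈ s, 0 ≤ f i) :
    ∑ i ∈ s.filter p, f i ≤ ∑ i ∈ s.filter q, f i :=
  Finset.sum_le_sum_of_subset_of_nonneg
    (fun i hi => by
      simp only [Finset.mem_filter] at hi ⊢
      exact ⟨hi.1, hpq i hi.1 hi.2⟩)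
    (fun i hi _ => hf i (Finset.mem_filter.1 hi).1)

/-- A filtered sub-sum of nonnegative real terms is at most the full sum. -/
theorem sum_filter_le_sum_of_nonneg {ι : Type*} (s : Finset ι) (f : ι → ℝ) (p : ι → Prop)
    [DecidablePred p] (hf : ∀ i ∈ s, 0 ≤ f i) :
    ∑ i ∈ s.filter p, f i ≤ ∑ i ∈ s, f i :=
  Finset.sum_le_sum_of_subset_of_nonneg (Finset.filter_subset _ _) (fun i hi _ => hf i hi)

/-! ### S5'(ii) from E1 + E2 -/

/-- **S5'(ii) ⇐ E1 + E2 (conditional reduction; E1, E2 are hypotheses, not asserted).** For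
`0 ≤ κ < ρ`, `CoherentReentryGap ρ` and `CleanMonopoleLowerBound κ` imply the second conjunct of the
windowed re-entry arm separation S5': fixed-radius re-entries carry a vanishing fraction of the
coherent weight even in inner-mass weighting, because `(t₀/r)^ρ · r^κ → 0`. The conclusion is conjunct
(ii) of the registered signature of `stub_reentryArmSeparation`, verbatim. -/
theorem reentryFixedRadius_of_armEstimates :
    ∀ ρ κ : ℝ, 0 ≤ κ → κ < ρ → CoherentReentryGap ρ → CleanMonopoleLowerBound κ →
      ∀ d₀ : ℝ, 0 ≤ d₀ → ∀ ϑ : ℝ, 0 < ϑ → ∃ r₀ : ℝ, ∀ r : ℝ, r₀ ≤ r →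
      ∀ Λ : Finset HexVertex, hexDomainSimplyConnected Λ → ∀ a ∈ hexDomainBoundary Λ, ∀ v ∈ Λ,
        Deep Λ v (2 * r) → ¬ Deep Λ v (4 * r) → ∀ w₀ w₁ w₂ : HexVertex, IsStar v w₀ w₁ w₂ →
          (∑ c ∈ (Conf Λ (ball Λ v r)).filter (fun c => ¬ Clean (ball Λ v r) c.1 v d₀),
              ‖amp Λ a (ball Λ v r) c‖ * pmass c.1 (root c) v w₀ w₁ w₂) ≤
            ϑ * ∑ c ∈ Conf Λ (ball Λ v r),
              ‖amp Λ a (ball Λ v r) c‖ * ‖mono c.1 (root c) v w₀ w₁ w₂‖ := by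
  intro ρ κ hκ hκρ h1 h2 d₀ hd₀ ϑ hϑ
  obtain ⟨C, hC, r₁, hE1⟩ := h1
  have hρ : 0 < ρ := lt_of_le_of_lt hκ hκρ
  -- an aspect ratio `θ` with `C θ^ρ ≤ 1/2`
  set b : ℝ := 1 / (2 * (C + 1)) with hb
  have hb0 : 0 < b := by positivity
  have hb1 : b < 1 := by
    rw [hb, div_lt_one (by positivity)]; linarith
  set θ : ℝ := b ^ (1 / ρ) with hθ
  have hθ0 : 0 < θ := Real.rpow_pos_of_pos hb0 _
  have hθ1 : θ < 1 := Real.rpow_lt_one hb0.le hb1 (by positivity)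
  have hθρ : θ ^ ρ = b := by rw [hθ, one_div, Real.rpow_inv_rpow hb0.le hρ.ne']
  have hCθ : C * θ ^ ρ ≤ 1 / 2 := by
    rw [hθρ, hb, mul_one_div, div_le_div_iff₀ (by positivity) (by norm_num)]
    linarith
  obtain ⟨c₀, hc₀, r₂, hE2⟩ := h2 θ hθ0 hθ1.le
  set t₀ : ℝ := max d₀ 1 with ht₀
  have ht₀1 : 1 ≤ t₀ := le_max_right _ _
  have hd₀t₀ : d₀ ≤ t₀ := le_max_left _ _
  have ht₀0 : 0 ≤ t₀ := zero_le_one.trans ht₀1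
  -- the constant in front of `r^(κ-ρ)` and the choice of `r₀`
  set K : ℝ := 2 * C * t₀ ^ ρ / c₀ with hK
  have hlim : Filter.Tendsto (fun r : ℝ => K * r ^ (κ - ρ)) Filter.atTop (nhds 0) := by
    have h := (tendsto_rpow_neg_atTop (y := ρ - κ) (by linarith)).const_mul K
    rw [mul_zero] at h
    refine h.congr' (Filter.Eventually.of_forall fun r => ?_)
    simp only [neg_sub]
  obtain ⟨R, hR⟩ := Filter.eventually_atTop.1 ((tendsto_order.1 hlim).2 ϑ hϑ)
  refine ⟨max (max r₁ r₂) (max (t₀ / θ) R), ?_⟩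
  intro r hr Λ hΛ a ha v hv hdeep hwin w₀ w₁ w₂ hstar
  have hr₁ : r₁ ≤ r := le_trans (le_trans (le_max_left _ _) (le_max_left _ _)) hr
  have hr₂ : r₂ ≤ r := le_trans (le_trans (le_max_right _ _) (le_max_left _ _)) hr
  have hrθ : t₀ / θ ≤ r := le_trans (le_trans (le_max_left _ _) (le_max_right _ _)) hr
  have hrR : R ≤ r := le_trans (le_trans (le_max_right _ _) (le_max_right _ _)) hr
  have hθr : t₀ ≤ θ * r := by rwa [div_le_iff₀ hθ0, mul_comm] at hrθ
  have hr0 : 0 < r := by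
    have : 0 < θ * r := lt_of_lt_of_le (lt_of_lt_of_le zero_lt_one ht₀1) hθr
    exact pos_of_mul_pos_right this hθ0.le
  have hθrr : θ * r ≤ r := mul_le_of_le_one_left hr0.le hθ1.le
  have ht₀r : t₀ ≤ r := hθr.trans hθrr
  set S : Finset HexVertex := ball Λ v r with hS
  -- abbreviations for the two weights
  set f : Config → ℝ := fun c => ‖amp Λ a S c‖ * pmass c.1 (root c) v w₀ w₁ w₂ with hf
  set g : Config → ℝ := fun c => ‖amp Λ a S c‖ * ‖mono c.1 (root c) v w₀ w₁ w₂‖ with hg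
  have hf0 : ∀ c, 0 ≤ f c := fun c => mul_nonneg (norm_nonneg _) (pmass_nonneg _ _ _ _ _ _)
  have hg0 : ∀ c, 0 ≤ g c := fun c => mul_nonneg (norm_nonneg _) (norm_nonneg _)
  -- E1 at `t₀` and at `θ r`
  have hP₁ : (∑ c ∈ (Conf Λ S).filter (fun c => ¬ Clean S c.1 v t₀), f c) ≤
      C * (t₀ / r) ^ ρ * ∑ c ∈ Conf Λ S, f c :=
    hE1 r hr₁ t₀ ht₀1 ht₀r Λ hΛ a ha v hv hdeep hwin w₀ w₁ w₂ hstar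
  have hP₂ : (∑ c ∈ (Conf Λ S).filter (fun c => ¬ Clean S c.1 v (θ * r)), f c) ≤
      C * (θ * r / r) ^ ρ * ∑ c ∈ Conf Λ S, f c :=
    hE1 r hr₁ (θ * r) (ht₀1.trans hθr) hθrr Λ hΛ a ha v hv hdeep hwin w₀ w₁ w₂ hstar
  have hθrr' : θ * r / r = θ := by field_simp
  rw [hθrr'] at hP₂
  -- split the total `f`-weight at cleanliness `θ r`; absorb the unclean part
  have hsplit := Finset.sum_filter_add_sum_filter_not (Conf Λ S) (fun c => Clean S c.1 v (θ * r)) f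
  have hPall : (∑ c ∈ Conf Λ S, f c) ≤
      2 * ∑ c ∈ (Conf Λ S).filter (fun c => Clean S c.1 v (θ * r)), f c := by
    have hnn : 0 ≤ ∑ c ∈ Conf Λ S, f c := Finset.sum_nonneg fun c _ => hf0 c
    have h1 : (∑ c ∈ (Conf Λ S).filter (fun c => ¬ Clean S c.1 v (θ * r)), f c) ≤
        1 / 2 * ∑ c ∈ Conf Λ S, f c := hP₂.trans (mul_le_mul_of_nonneg_right hCθ hnn)
    linarith [hsplit, h1]
  -- E2: clean configurations convert inner mass into monopole at the price `c₀⁻¹ r^κ`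
  have hQ : (∑ c ∈ (Conf Λ S).filter (fun c => Clean S c.1 v (θ * r)), f c) ≤
      c₀⁻¹ * r ^ κ * ∑ c ∈ (Conf Λ S).filter (fun c => Clean S c.1 v (θ * r)), g c := by
    rw [Finset.mul_sum]
    refine Finset.sum_le_sum fun c hc => ?_
    rw [Finset.mem_filter] at hc
    by_cases hamp : amp Λ a S c = 0
    · have : f c = 0 := by simp [hf, hamp]
      rw [this]
      exact mul_nonneg (mul_nonneg (inv_nonneg.2 hc₀.le) (Real.rpow_nonneg hr0.le _)) (hg0 c)
    · have key := hE2 r hr₂ Λ hΛ a ha v hv hdeep hwin w₀ w₁ w₂ hstar c hc.1 hamp hc.2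
      have hrk : r ^ (-κ) = (r ^ κ)⁻¹ := Real.rpow_neg hr0.le κ
      have hrκ : 0 < r ^ κ := Real.rpow_pos_of_pos hr0 κ
      rw [hrk] at key
      -- `pmass ≤ c₀⁻¹ r^κ ‖mono‖`
      have key' : pmass c.1 (root c) v w₀ w₁ w₂ ≤
          c₀⁻¹ * r ^ κ * ‖mono c.1 (root c) v w₀ w₁ w₂‖ := by
        rw [← div_le_iff₀' (by positivity)]
        calc pmass c.1 (root c) v w₀ w₁ w₂ / (c₀⁻¹ * r ^ κ)
            = c₀ * (r ^ κ)⁻¹ * pmass c.1 (root c) v w₀ w₁ w₂ := by field_simp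
          _ ≤ _ := key
      calc f c = ‖amp Λ a S c‖ * pmass c.1 (root c) v w₀ w₁ w₂ := rfl
        _ ≤ ‖amp Λ a S c‖ * (c₀⁻¹ * r ^ κ * ‖mono c.1 (root c) v w₀ w₁ w₂‖) :=
            mul_le_mul_of_nonneg_left key' (norm_nonneg _)
        _ = c₀⁻¹ * r ^ κ * g c := by simp only [hg]; ring
  have hN : (∑ c ∈ (Conf Λ S).filter (fun c => Clean S c.1 v (θ * r)), g c) ≤
      ∑ c ∈ Conf Λ S, g c := sum_filter_le_sum_of_nonneg _ _ _ fun c _ => hg0 c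
  -- the left side is monotone in the radius
  have hL : (∑ c ∈ (Conf Λ S).filter (fun c => ¬ Clean S c.1 v d₀), f c) ≤
      ∑ c ∈ (Conf Λ S).filter (fun c => ¬ Clean S c.1 v t₀), f c :=
    sum_filter_le_sum_filter_of_imp _ _ _ _
      (fun c _ hn hcl => hn (clean_anti S c.1 v d₀ t₀ hd₀t₀ hcl)) fun c _ => hf0 c
  -- assemble
  have hNnn : 0 ≤ ∑ c ∈ Conf Λ S, g c := Finset.sum_nonneg fun c _ => hg0 c
  have hpow : (t₀ / r) ^ ρ * r ^ κ = t₀ ^ ρ * r ^ (κ - ρ) := by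
    rw [Real.div_rpow ht₀0 hr0.le, Real.rpow_sub hr0]
    field_simp
  have hKr : K * r ^ (κ - ρ) < ϑ := hR r hrR
  calc (∑ c ∈ (Conf Λ S).filter (fun c => ¬ Clean S c.1 v d₀), f c)
      ≤ C * (t₀ / r) ^ ρ * ∑ c ∈ Conf Λ S, f c := hL.trans hP₁
    _ ≤ C * (t₀ / r) ^ ρ * (2 * (c₀⁻¹ * r ^ κ * ∑ c ∈ Conf Λ S, g c)) := by
        have : 0 ≤ C * (t₀ / r) ^ ρ := mul_nonneg hC (Real.rpow_nonneg (by positivity) _)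
        refine mul_le_mul_of_nonneg_left (hPall.trans ?_) this
        exact mul_le_mul_of_nonneg_left (hQ.trans (mul_le_mul_of_nonneg_left hN (by positivity)))
          (by norm_num)
    _ = K * r ^ (κ - ρ) * ∑ c ∈ Conf Λ S, g c := by
        rw [hK]
        have : C * (t₀ / r) ^ ρ * (2 * (c₀⁻¹ * r ^ κ * ∑ c ∈ Conf Λ S, g c)) =
            2 * C / c₀ * ((t₀ / r) ^ ρ * r ^ κ) * ∑ c ∈ Conf Λ S, g c := by
          field_simp
        rw [this, hpow]
        ring
    _ ≤ ϑ * ∑ c ∈ Conf Λ S, g c := mul_le_mul_of_nonneg_right hKr.le hNnn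

end Summit.CriticalPhenomena.SAWScalingLimit.Theorems.InteriorFlattening.OneMouth

end
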